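import Summits.HodgeConjecture.HodgeConjecture.Theorems.F0P3cStCharTSStOneDim     -- ★-cand (this seat) S4b FILE C «ST-ONE-DIM★»: `exists_ofChar_isConstituentOf_stChar`, `exists_subrepresentation_ne_bot_ne_top_stChar` (Keys (1)(a))
import Summits.HodgeConjecture.HodgeConjecture.Theorems.F0P3cStCharTSStLabels     -- ★ p851392 (F0P3-p01 (g22)) S4b FILE B «ST-LABELS★»: `stLabels`, `isSquareIntegrable_of_isConstituentOf_stChar_of_ne` (Keys (1) labelled pair)
import Literature.NumberTheory.Rogawski1990.Ch12Sec5Defs                           -- ★ `Ch12Sec5.EllipticData` (the (S-𝔇) datum vocabulary: `stG`, `IsL2`, `μGZ`)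
import HarnessLib

/-!
# F0 · P3c · line LH6 «StCharTS» — «ST-FIELD★»: THE (ST-L2) CONJUNCT «`St_G(ψ)` IS SQUARE-INTEGRABLE» OF THE (S-𝔇) ORGAN, AS A THEOREM at every §12.5 datum whose
# field `stG` is «the constituent of the case-(1) principal series `i_G(χ_St(ψ))` other than the one-dimensional `ψ∘det_G`» [Rogawski1990, §12.2 (1)]
# (datum road MAP-DATUM-ROAD, slice S4b, file D = B ∘ C)

Cell `pub/hodgecm-mathlib`, crux H413 = `stmt-HodgeConjecture-24833` (lane `--supports … --as helper`), route HCCMUnconditional; seat F0P2-p06 (g17).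
THEOREMS ONLY (no definition ∕ instance ∕ notation ∕ named fact ∕ `sorry`); ★-only imports.

WHAT.  The (S-𝔇) organ `stub_EllipticPackage` of `Cruxes/H413/Lines/F0_P3c_StCharTSPaydown.lean` carries the conjunct (ST-L2)
`∀ ψ' : ↥(Subgroup.center (Gqs L v)) →* ℂˣ, Continuous ψ' → 𝔇.IsL2 (𝔇.stG ψ')` [§12.1–12.2: the Steinberg representations are square-integrable].  Print's
definition of the field is «`JH(i_G(χ)) = {ψ∘det_G, St_G(ψ)}` in case (1)» [§12.2 (1) p. 173]; accordingly the field hypothesis (road rule §2.1, no definition)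
`hSt` pins `𝔇.stG ψ'` as a constituent of the case-(1) principal series `i_G(χ_St(ψ))` = ★ `cmPrincipalSeries L 3 v (cmTorusCharPair L v (‖·‖^{1/2}‖·‖^{1/2})⁻¹ ψ)`
for some continuous `ψ : E¹_v →* ℂˣ` (the `E¹`-reading of `ψ'`), DIFFERENT FROM EVERY ONE-DIMENSIONAL CLASS `⟦ξ⟧` (★ `SmoothIrrep.ofChar`).  Then (ST-L2) holds:
by ★ FILE C (Keys (1)(a): `i_G(χ_St(ψ))` is reducible; `⟦ψ∘det⟧` is a constituent with exponent `χ_St(ψ)`) and ★ FILE B (Keys (1): the constituents are exactly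
a one-with-exponent-`χ_St` class `π₁` (not L²) and a one-with-exponent-`wχ_St` class `πSt` (L², Casselman ★ N5)), the one-dimensional `⟦ψ∘det⟧` IS `π₁`
(its exponent is `χ_St ≠ wχ_St`, ★ G5 + ★ R1), so a constituent other than it is `πSt`, square-integrable:
* `mk_ofChar_ne_of_jacquet_weylStChar` — a one-dimensional class with exponent `χ_St(ψ)` is not a class with `r ≅ wχ_St(ψ)`;
* `isSquareIntegrable_of_isConstituentOf_stChar_of_ne_ofChar` — the model statement: a constituent of `i_G(χ_St(ψ))` other than every `⟦ofChar ξ⟧` is L² mod centre;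
* `stL2_of_stField` — (ST-L2) TOKEN FOR TOKEN at every `𝔇 : EllipticData (Gqs L v) H'` with `𝔇.μGZ = μZ` and the field hypothesis `hSt`.
HONEST LABEL: HC_CM is proved only modulo the 7 printed citations (2 remaining named inputs: hLiu418 = `stmt-HodgeConjecture-24832`, h413 =
`stmt-HodgeConjecture-24833`) until rung 0 closes; this file closes no organ — at the concrete datum (ST-L2) leaves (S-𝔇) as an in-house theorem (count-neutral).

## References
* [Rogawski1990] J. D. Rogawski, *Automorphic Representations of Unitary Groups in Three Variables*, Ann. of Math. Stud. 123 (1990): §12.1 p. 172, §12.2 (1) p. 173.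
* [Keys1984] D. Keys, *Principal series representations of special unitary groups over local fields*, Compositio Math. 51 (1984), §7 Theorem.
* [Casselman1995] W. Casselman, *Introduction to the theory of admissible representations of `p`-adic reductive groups* (1995), Thm 4.4.6, §7.1.
-/

set_option autoImplicit false
-- the mandated namespace has the single-problem summit's repeated segment (`HodgeConjecture.HodgeConjecture`)
set_option linter.dupNamespace false

noncomputable section

open NumberField IsDedekindDomain MeasureTheory Topology
open scoped Matrix MatrixGroups NNReal
open Literature.NumberTheory.Rogawski1990 Literature.NumberTheory.Automorphic Literature.NumberTheory.Automorphic.UnitaryGroup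
open Literature.NumberTheory.Rogawski1990.Ch12Sec5

namespace Summit.HodgeConjecture.HodgeConjecture.Cruxes.H413.F0P3cStCharTSStField

variable (L : Type) [Field L] [NumberField L] [IsCMField L] (v : HeightOneSpectrum (𝓞 ↥(maximalRealSubfield L)))

/-! ## §1 A one-dimensional class with exponent `χ_St(ψ)` is not the Steinberg label (exponent `wχ_St(ψ)`) -/

set_option synthInstance.maxHeartbeats 400000 in
set_option maxHeartbeats 4000000 in  -- `Gqs L v` vs the literal carrier `↥(unitaryGroupOfForm (conjLocal …) (cmLocalForm L 3 v))` (defeq ★ `cmDatum_Local_eq`; instance-path unification, cf. ★ `F0P3KeysCaseTwoOfStubs`)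
/-- **`⟦ξ⟧ ≠ πSt`**: a class with a representative whose normalised Jacquet module is `≅ wχ_St(ψ)` is NOT the class of a one-dimensional `ξ` having `χ_St(ψ)` as an exponent —
along the equivalence of representatives (★ `IrrClass.mk_eq_mk_iff`, ★ `jacquetMap_equiv_injective`, ★ `HasJacquetExponent.map_of_injective`) the exponent `χ_St(ψ)` would be
an exponent of a module `≅ wχ_St(ψ)`, forcing `χ_St(ψ) = wχ_St(ψ)` (★ G5 `HasJacquetExponent.eq_of_equiv_twist_trivial`) against ★ R1 `stChar_ne_weylStChar`.
[cite: Rogawski1990, §12.2 (1) p. 173] [cite: Casselman1995, §4.4 p. 45, Prop. 6.4.1] -/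
theorem mk_ofChar_ne_of_jacquet_weylStChar (ψ : ↥(normOneUnits (conjLocal L (IsCMField.complexConj L) v)) →* ℂˣ)
    (ξ : Gqs L v →* ℂˣ) (hξ : IsOpen ((ξ.ker : Subgroup (Gqs L v)) : Set (Gqs L v)))
    (hexp : haveI := locallyCompactSpace_cmBorelU L 3 v
      (SmoothIrrep.ofChar ξ hξ).ρ.HasJacquetExponent (cmBorelTriple L 3 v)
        (cmTorusCharPair L v (halfModulusChar (LocalRing L v) * halfModulusChar (LocalRing L v))⁻¹ ψ))
    (c : IrrClass (Gqs L v))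
    (hc : haveI := locallyCompactSpace_cmBorelU L 3 v
      ∃ r : SmoothIrrep (Gqs L v), IrrClass.mk r = c ∧
        Nonempty ((r.ρ.normalizedJacquet (cmBorelTriple L 3 v)).Equiv
          ((Representation.trivial ℂ ↥(torusU (conjLocal L (IsCMField.complexConj L) v) (cmLocalForm L 3 v)) ℂ).twist
            (cmWeylTorusCharPair L v (halfModulusChar (LocalRing L v) * halfModulusChar (LocalRing L v))⁻¹ ψ)))) :
    IrrClass.mk (SmoothIrrep.ofChar ξ hξ) ≠ c := by
  haveI := locallyCompactSpace_cmBorelU L 3 v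
  intro h
  obtain ⟨r, hrc, ⟨e⟩⟩ := hc
  obtain ⟨E⟩ := (IrrClass.mk_eq_mk_iff (SmoothIrrep.ofChar ξ hξ) r).1 (h.trans hrc.symm)
  -- transport the exponent `χ_St(ψ)` along `E`, then read it on `r(r.ρ) ≅ wχ_St(ψ)`
  have hexp' := hexp.map_of_injective (cmBorelTriple L 3 v) E.toIntertwiningMap (IrrClass.jacquetMap_equiv_injective (cmBorelTriple L 3 v) E)
  exact F0P3cStCharTSStChar.stChar_ne_weylStChar L v ψ (hexp'.eq_of_equiv_twist_trivial (cmBorelTriple L 3 v) e)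

/-! ## §2 The model statement: a constituent of `i_G(χ_St(ψ))` other than every one-dimensional class is square-integrable -/

set_option synthInstance.maxHeartbeats 400000 in
set_option maxHeartbeats 8000000 in  -- carrier bookkeeping as in ★ `F0P3cStCharTSStLabels` (B4)∕(B6)
/-- **«`St_G(ψ)` IS SQUARE-INTEGRABLE», MODEL FORM** (non-split `v`): a constituent `c` of the case-(1) principal series `i_G(χ_St(ψ))` of `U(Φ₃)(L⁺_v)` which differs from
every one-dimensional class `⟦ξ⟧` is square-integrable modulo the centre.  ★ FILE C supplies the reducibility of `i_G(χ_St(ψ))` (Keys (1)(a)) and the one-dimensional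
constituent `⟦ψ∘det⟧` with exponent `χ_St(ψ)`; ★ FILE B (B4) lists the constituents as `{π₁, πSt}` with `πSt` L² and `π₁` not, `r(πSt) ≅ wχ_St(ψ)`; by §1 `⟦ψ∘det⟧ ≠ πSt`,
so `⟦ψ∘det⟧ = π₁` is THE non-square-integrable constituent and ★ (B6) applies. [cite: Rogawski1990, §12.1 p. 172; §12.2 (1) p. 173] [cite: Keys1984, §7 Theorem]
[cite: Casselman1995, Thm 4.4.6] -/
theorem isSquareIntegrable_of_isConstituentOf_stChar_of_ne_ofChar
    (hns : ∀ w : PlacesOver L v, IsCMField.complexConj L • w.1 = w.1)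
    [MeasurableSpace (Gqs L v ⧸ Subgroup.center (Gqs L v))] [BorelSpace (Gqs L v ⧸ Subgroup.center (Gqs L v))]
    (μZ : Measure (Gqs L v ⧸ Subgroup.center (Gqs L v))) [μZ.IsHaarMeasure]
    (ψ : ↥(normOneUnits (conjLocal L (IsCMField.complexConj L) v)) →* ℂˣ) (hψ : Continuous ψ)
    (c : IrrClass (Gqs L v))
    (hc : c.IsConstituentOf (cmPrincipalSeries L 3 v (cmTorusCharPair L v (halfModulusChar (LocalRing L v) * halfModulusChar (LocalRing L v))⁻¹ ψ)))
    (hne : ∀ (ξ : Gqs L v →* ℂˣ) (hξ : IsOpen ((ξ.ker : Subgroup (Gqs L v)) : Set (Gqs L v))), c ≠ IrrClass.mk (SmoothIrrep.ofChar ξ hξ)) :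
    c.IsSquareIntegrable μZ := by
  have hψc : Continuous fun x => ((ψ x : ℂˣ) : ℂ) := Units.continuous_val.comp hψ
  -- Keys (1)(a): `i_G(χ_St(ψ))` is reducible (★ FILE C)
  have hred := F0P3cStCharTSStOneDim.exists_subrepresentation_ne_bot_ne_top_stChar L v hns ψ hψ
  -- the one-dimensional constituent and its exponent (★ FILE C)
  obtain ⟨ξ, hξ, hξc, hξexp⟩ := F0P3cStCharTSStOneDim.exists_ofChar_isConstituentOf_stChar L v ψ hψ
  -- the labelled pair (★ FILE B)
  obtain ⟨π₁, πSt, -, hall, hs, -, -, hJSt⟩ := F0P3cStCharTSStLabels.stLabels L v hns μZ ψ hψc hred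
  refine F0P3cStCharTSStLabels.isSquareIntegrable_of_isConstituentOf_stChar_of_ne L v hns μZ ψ hψc hred c hc fun c' hc' hn hcc' => ?_
  -- `c'` non-L² ⇒ `c' = π₁`; `⟦ξ⟧ ≠ πSt` ⇒ `⟦ξ⟧ = π₁`; so `c = ⟦ξ⟧`, excluded
  have hc'1 : c' = π₁ := by
    rcases (hall c').1 hc' with h | h
    · exact absurd (h ▸ hs) hn
    · exact h
  have hξ1 : IrrClass.mk (SmoothIrrep.ofChar ξ hξ) = π₁ := by
    rcases (hall _).1 hξc with h | h
    · exact absurd h (mk_ofChar_ne_of_jacquet_weylStChar L v ψ ξ hξ hξexp πSt hJSt)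
    · exact h
  exact hne ξ hξ (hcc'.trans (hc'1.trans hξ1.symm))

/-! ## §3 The datum-road form (rule §2.1 of MAP-DATUM-ROAD): (ST-L2) at every `𝔇` with the field hypothesis on `stG` -/

section Datum

variable [MeasurableSpace (Gqs L v)]
  [∀ γ : Gqs L v, MeasurableSpace (Gqs L v ⧸ Subgroup.centralizer ({γ} : Set (Gqs L v)))]
  [MeasurableSpace (Gqs L v ⧸ Subgroup.center (Gqs L v))] [BorelSpace (Gqs L v ⧸ Subgroup.center (Gqs L v))]
  {H' : Type} [Group H'] [TopologicalSpace H'] [IsTopologicalGroup H'] [MeasurableSpace H']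

set_option synthInstance.maxHeartbeats 400000 in
set_option maxHeartbeats 4000000 in  -- as §2
/-- **(ST-L2) OF THE (S-𝔇) ORGAN, TOKEN FOR TOKEN, AS A THEOREM** at every §12.5 datum `𝔇` on `U(Φ₃)(L⁺_v)` (non-split `v`) whose Haar measure on `G ⧸ Z` is the
organ's `μZ` (COMPAT `hμGZ`) and whose Steinberg field `stG ψ'` is, for every continuous character `ψ'` of the centre, «a constituent of the case-(1) principal series
`i_G(χ_St(ψ))` for a continuous `ψ ∈ Hom(E¹_v, ℂ^*)`, other than every one-dimensional class» (`hSt`, the print's `JH(i_G(χ)) = {ψ∘det_G, St_G(ψ)}` [§12.2 (1)]):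
`∀ ψ', Continuous ψ' → 𝔇.IsL2 (𝔇.stG ψ')`. [cite: Rogawski1990, §12.1 p. 172; §12.2 (1) p. 173] [cite: Keys1984, §7 Theorem] [cite: Casselman1995, Thm 4.4.6] -/
theorem stL2_of_stField (hns : ∀ w : PlacesOver L v, IsCMField.complexConj L • w.1 = w.1)
    (μZ : Measure (Gqs L v ⧸ Subgroup.center (Gqs L v))) [μZ.IsHaarMeasure]
    (𝔇 : EllipticData (Gqs L v) H') (hμGZ : 𝔇.μGZ = μZ)
    (hSt : ∀ ψ' : ↥(Subgroup.center (Gqs L v)) →* ℂˣ, Continuous ψ' →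
      ∃ ψ : ↥(normOneUnits (conjLocal L (IsCMField.complexConj L) v)) →* ℂˣ, Continuous ψ ∧
        (𝔇.stG ψ').IsConstituentOf
            (cmPrincipalSeries L 3 v (cmTorusCharPair L v (halfModulusChar (LocalRing L v) * halfModulusChar (LocalRing L v))⁻¹ ψ)) ∧
        ∀ (ξ : Gqs L v →* ℂˣ) (hξ : IsOpen ((ξ.ker : Subgroup (Gqs L v)) : Set (Gqs L v))), 𝔇.stG ψ' ≠ IrrClass.mk (SmoothIrrep.ofChar ξ hξ)) :
    ∀ ψ' : ↥(Subgroup.center (Gqs L v)) →* ℂˣ, Continuous ψ' → 𝔇.IsL2 (𝔇.stG ψ') := by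
  intro ψ' hψ'
  obtain ⟨ψ, hψ, hc, hne⟩ := hSt ψ' hψ'
  show IrrClass.IsSquareIntegrable 𝔇.μGZ (𝔇.stG ψ')
  rw [hμGZ]
  exact isSquareIntegrable_of_isConstituentOf_stChar_of_ne_ofChar L v hns μZ ψ hψ _ hc hne

end Datum

end Summit.HodgeConjecture.HodgeConjecture.Cruxes.H413.F0P3cStCharTSStField

end
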